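import Summits.QuantumFields.BalabanUV.Beta.GAN24.LayerTransportBiLoc
import Summits.QuantumFields.BalabanUV.Beta.GAN24.RespStepSecondDiff

/-!
# `BalabanUV.Beta.GAN24.LayerTransportUndressedThree` — binder row G-an2-4 ∕ (CONV-C), W-slot CT-W, route «WC-TL» ∕ «QR-LL», row **(LT-Δ) «LAYER TRANSPORT»**, part (LT-UUU):
# **THE PURE CELL OF THE LAYER BOUND ON THE UNDRESSED COMPOSITE COLUMNS, LEG ROWS DISCHARGED** — `biLoc_cubic_push₃_layer_three_weight` (`LayerTransportBiLoc`, p324201 ✓) with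
# all THREE legs := an2's decimated composite minimiser column `respStep (Lc^(m+1)) (Lc^(m+1+k+1))` (the undressed part `U` of the dressed chain
# `legChain (respStepBmSeq ρ Lc) (m+1) k`, `RespStepBmDecompPsi.legAct_legChain_respStepBm`), whose (N1) ∕ (N1′) ∕ (N1″)_{1∕2} envelopes ARE TREE THEOREMS
# (leaf-12 `RespStepDecay` ⨾ leaf-02 g54∕g55 `RespStepSecondDiff.exists_respStep_decay_grad_diff2_l1`, uniform in `(m, k)`, one rate) — so the (UUU) cell of the eight-cell socket
# (`LayerTransportCells`) holds for EVERY small enough wobble rate `κ`, modulo ONLY the letter-side rows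

NOT IN PRINT; OUR BOOKKEEPING ([folklore] rate weakening `e^{−κ₀t} ≤ e^{−κt}` ⨾ `LayerTransportBiLoc.biLoc_cubic_push₃_layer_three_weight` ⨾ `RespStepSecondDiff.exists_respStep_decay_grad_diff2_l1`
BY NAME; G-an2-4 formalisation swarm, leaf prover `b2b-balaban-gan24-formalise-leaf-01`, gen 65, INTENT I-leaf01-g65-3).  HONEST FRAMING (cell contract, verbatim): «discharging
`BetaPertH` makes Bałaban's UV stability UNCONDITIONAL — a real constructive-QFT result; it is NOT the continuum limit and NOT the Clay problem.»  HONEST DEPENDENCY (verbatim):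
«continuum YM on T⁴ ⇐ BetaPertH ∧ nine spine estimates (0/9 proved); BetaPertH ⇐ (D1) ∧ (D4) ∧ CAP+tail; G-an2-4 gates asym, D1 and NE2/3/4.»

## What (`d = 3`, every blocking factor `Lc ≥ 1`)
§1 `exp_rate_weaken` (an envelope at rate `κ₀` is an envelope at every rate `κ ≤ κ₀`).
§2 **`biLoc_cubic_push₃_respStep_three`**: the three (N1)∕(N1′)∕(N1″)_{1∕2} envelope clauses of `respStep (Lc^(m+1)) (Lc^(m+1+k+1))` AT A RATE `κ₀` (the shape of
   `exists_respStep_decay_grad_diff2_l1`, verbatim at the pair `(m+1, k)`) + any wobble rate `0 < κ ≤ κ₀` + the letter-side rows of the (LT-3) END at `κ` (`hS hω hQ hZ hM0 hP1 hTl hTcard`,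
   `κ < m′`, `4κ < δZ`) ⊢ `BiLoc ((Lc^(k+1))^{12} • push₃ U U U S ν U₀) U₀ U₀ (K·(√(Lc^(k+1)))⁻¹·e^{−min(κ∕2,δ∕2)‖y−U₀‖₁}) (κ∕4)`, `U = respStep (Lc^(m+1)) (Lc^(m+1+k+1))`, `K` the explicit
   constant of the (LT-3) END in `A, A′, A″, κ, …`.
§3 **`exists_biLoc_cubic_push₃_respStep_three`** — THE LEG ROWS DISCHARGED: there are `κ₀ > 0` and `A, A′, A″ ≥ 0` (leaf-12∕leaf-02's, level-free) such that §2's conclusion holds for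
   ALL `m k`, all `0 < κ ≤ κ₀` and all letter data satisfying the letter-side rows — the (UUU) cell of `LayerTransportCells.biLoc_smul_push₃_of_cells` for the literal's undressed
   columns, modulo the letter side ONLY ((LAY)∕(CE) `hS hω hQ hZ hTl hTcard`, (S) `hM0 hP1`).  (The ratio `(√(Lc^(k+1)))⁻¹ = ((√Lc)⁻¹)^(k+1)` is the OWNER's
   `WardRemainderTransportedLetter.inv_sqrt_natCast_pow`, applied on his side.)
NOT typed here: the seven gauge cells (K-LL-4, OPEN), the split identity at leg-family level, any letter row.  [folklore]; 0 cited facts, 0 `def`, 0 `def … : Prop`, 0 sorry.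
NOTHING of (Q-R)∕(LT)∕(Q-L)∕(C)∕(S)∕«T2Shape»∕«T2Drift»∕(hW, hWall) discharged; NEVER «G-an2-4 closed» as (CONV-C); NOT D1, NOT `BetaPertH`, NOT continuum, NOT Clay.  2026-08-22; no existing file touched.
-/

noncomputable section

open Finset
open scoped BigOperators
open Literature.MathematicalPhysics.QuantumFieldTheory
open Literature.MathematicalPhysics.QuantumFieldTheory.Balaban1983to89
open Literature.MathematicalPhysics.QuantumFieldTheory.Balaban1983to89.Beta
open B12Sec2to5 (l1 l1_nonneg)
open B6BondElimination (unitVec)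
open ExpKernelCalculus (MKer Site BiLoc Zl)
open OneStepResolventKernel (Fib)
open LatticeForm (quo)
open AffineAveraging (box toSite)
open BalabanCompositeJets (respStep)
open Summit.QuantumFields.BalabanUV.Beta.GAN24.Push3 (push₃)
open Summit.QuantumFields.BalabanUV.Beta.GAN24.LayerTransportBiLoc (biLoc_cubic_push₃_layer_three_weight)
open Summit.QuantumFields.BalabanUV.Beta.GAN24.RespStepSecondDiff (exists_respStep_decay_grad_diff2_l1)

namespace Summit.QuantumFields.BalabanUV.Beta.GAN24.LayerTransportUndressedThree

/-! ## §1 Rate weakening -/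

/-- [folklore] An exponential envelope at rate `κ₀` is an envelope at every rate `κ ≤ κ₀` (nonnegative prefactor, nonnegative distance). -/
theorem exp_rate_weaken {κ κ₀ t P : ℝ} (hκ : κ ≤ κ₀) (ht : 0 ≤ t) (hP : 0 ≤ P) {v : ℝ} (h : v ≤ P * Real.exp (-κ₀ * t)) :
    v ≤ P * Real.exp (-κ * t) :=
  h.trans (mul_le_mul_of_nonneg_left (Real.exp_le_exp.2 (by nlinarith)) hP)

/-! ## §2 The pure cell on the undressed composite columns, envelopes displayed at a rate `κ₀` -/

section Three

variable {Lc : ℕ} [NeZero Lc]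

/-- NOT IN PRINT; OUR BOOKKEEPING.  **THE (UUU) CELL ON an2's DECIMATED COMPOSITE COLUMNS**: with `U := respStep (Lc^(m+1)) (Lc^(m+1+k+1))` as all three legs, the three envelope
clauses of `RespStepSecondDiff.exists_respStep_decay_grad_diff2_l1` at the pair `(m+1, k)` and rate `κ₀` (hypotheses `hU0 ∕ hU1 ∕ hU2`, verbatim shape), a wobble rate
`0 < κ ≤ κ₀`, and the letter-side rows of the (LT-3) END at `κ` give the END's `BiLoc` at `U₀` with ratio `(√(Lc^(k+1)))⁻¹` and weight `e^{−min(κ∕2,δ∕2)‖y−U₀‖₁}`. -/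
theorem biLoc_cubic_push₃_respStep_three (m k : ℕ) {κ₀ κ A A' A'' : ℝ} (hκ : 0 < κ) (hκκ₀ : κ ≤ κ₀) (hA : 0 ≤ A) (hA' : 0 ≤ A') (hA'' : 0 ≤ A'')
    (hU0 : ∀ (μ : Fin (3 + 1)) (z : Fin (3 + 1) → ℤ) (l'' : Fin (3 + 1)) (w' : Fin (3 + 1) → ℤ),
      |respStep (d := 3) (Lc ^ (m + 1)) (Lc ^ (m + 1 + k + 1)) μ z l'' w'|
        ≤ A * ((((Lc ^ (k + 1) : ℕ) : ℝ)) ^ (3 + 2))⁻¹ * Real.exp (-κ₀ * l1 (quo (Lc ^ (k + 1)) w' - z)))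
    (hU1 : ∀ (μ : Fin (3 + 1)) (z : Fin (3 + 1) → ℤ) (l'' : Fin (3 + 1)) (w' : Fin (3 + 1) → ℤ) (ν : Fin (3 + 1)),
      |respStep (d := 3) (Lc ^ (m + 1)) (Lc ^ (m + 1 + k + 1)) μ z l'' (w' + Pi.single ν 1) - respStep (d := 3) (Lc ^ (m + 1)) (Lc ^ (m + 1 + k + 1)) μ z l'' w'|
        ≤ A' * ((((Lc ^ (k + 1) : ℕ) : ℝ)) ^ (3 + 3))⁻¹ * Real.exp (-κ₀ * l1 (quo (Lc ^ (k + 1)) w' - z)))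
    (hU2 : ∀ (μ : Fin (3 + 1)) (z : Fin (3 + 1) → ℤ) (l'' : Fin (3 + 1)) (w' : Fin (3 + 1) → ℤ) (ν ν' : Fin (3 + 1)),
      |(respStep (d := 3) (Lc ^ (m + 1)) (Lc ^ (m + 1 + k + 1)) μ z l'' (w' + Pi.single ν 1 + Pi.single ν' 1)
          - respStep (d := 3) (Lc ^ (m + 1)) (Lc ^ (m + 1 + k + 1)) μ z l'' (w' + Pi.single ν' 1))
        - (respStep (d := 3) (Lc ^ (m + 1)) (Lc ^ (m + 1 + k + 1)) μ z l'' (w' + Pi.single ν 1) - respStep (d := 3) (Lc ^ (m + 1)) (Lc ^ (m + 1 + k + 1)) μ z l'' w')|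
        ≤ A'' * ((((Lc ^ (k + 1) : ℕ) : ℝ)) ^ (3 + 3) * Real.sqrt (((Lc ^ (k + 1) : ℕ) : ℝ)))⁻¹ * Real.exp (-κ₀ * l1 (quo (Lc ^ (k + 1)) w' - z)))
    {S : Fin (3 + 1) → (Fin (3 + 1) → ℤ) → MKer (3 + 1) (Fib 3)} {ω : (Fin (3 + 1) → ℤ) → ℝ}
    {Z : Fin (3 + 1) → Fin (3 + 1) → Fin (3 + 1) → (Fin (3 + 1) → ℤ) → (Fin (3 + 1) → ℤ) → ℝ} {T' : Finset (Fin (3 + 1) → ℤ)}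
    {Cs m' δ B δZ ρ CT : ℝ} (hm : κ < m') (hδ : 0 < δ) (hCs : 0 ≤ Cs) (hB : 0 ≤ B) (hκδZ : 4 * κ < δZ)
    (hS : ∀ k' u x z a b, |S k' u x z a b| ≤ Cs * ω u * Real.exp (-m' * (l1 (x - u) + l1 (z - u))))
    (y : Fin (3 + 1) → ℤ)
    (hω : ∀ u, 0 ≤ ω u ∧ ω u ≤ ∑ μ : Fin (3 + 1),
      (∑ v ∈ ((box (3 + 1) (Lc ^ (k + 1))).filter (fun v => v μ = Lc ^ (k + 1) - 1)).image (fun v => ((Lc ^ (k + 1) : ℕ) : ℤ) • y + toSite v),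
          Real.exp (-δ * l1 (v - u))
        + ∑ v ∈ ((box (3 + 1) (Lc ^ (k + 1))).filter (fun v => v μ = 0)).image (fun v => ((Lc ^ (k + 1) : ℕ) : ℤ) • y + toSite v - unitVec μ),
            Real.exp (-δ * l1 (v - u))))
    (hQ : ∀ k' κ₁ κ₂ u, ∑' x, ∑' z, S k' u x z (Sum.inl κ₁) (Sum.inl κ₂) = ∑ y' ∈ T', Z k' κ₁ κ₂ y' u)
    (hZ : ∀ k' κ₁ κ₂, ∀ y' ∈ T', ∀ e, |Z k' κ₁ κ₂ y' e| ≤ B * Real.exp (-δZ * l1 (e - y')))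
    (hM0 : ∀ k' κ₁ κ₂, ∀ y' ∈ T', ∑' e, Z k' κ₁ κ₂ y' e = 0)
    (hP1 : ∀ k' κ₁ κ₂, ∀ y' ∈ T', ∀ i : Fin (3 + 1), ∑' e, (((e - y') i : ℤ) : ℝ) * Z k' κ₁ κ₂ y' e = 0)
    (hTl : ∀ y' ∈ T', l1 (quo (Lc ^ (k + 1)) y' - y) ≤ ρ) (hTcard : (T'.card : ℝ) ≤ CT * (((Lc ^ (k + 1) : ℕ) : ℝ)) ^ (3 + 1))
    (ν : Fin (3 + 1)) (U₀ : Fin (3 + 1) → ℤ) :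
    BiLoc (((((Lc ^ (k + 1) : ℕ) : ℝ)) ^ (3 * (3 + 1))) •
        push₃ (respStep (d := 3) (Lc ^ (m + 1)) (Lc ^ (m + 1 + k + 1))) (respStep (d := 3) (Lc ^ (m + 1)) (Lc ^ (m + 1 + k + 1)))
          (respStep (d := 3) (Lc ^ (m + 1)) (Lc ^ (m + 1 + k + 1))) S ν U₀) U₀ U₀
      ((((((3 : ℝ) + 1) ^ 3 * A ^ 2 * A' * Cs * (2 / (m' - κ) * Zl (3 + 1) ((m' - κ) / 2)) * (Zl (3 + 1) (m' - κ) + Zl (3 + 1) m'))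
            * ((2 * ((3 : ℝ) + 1)) ^ 2 * Zl (3 + 1) (δ / 2) * Real.exp (min (κ / 2) (δ / 2))))
        + ((3 : ℝ) + 1) ^ 3 *
          ((((A'' * A * A + 2 * A' * A' * A + A * A'' * A) * Real.exp (2 * κ) + 2 * ((A' * A + A * A') * Real.exp κ) * A' + A * A * A'')
              * Real.exp (2 * (2 * κ))) * B * (8 / (δZ - 2 * (2 * κ)) ^ 2 * Zl (3 + 1) ((δZ - 2 * (2 * κ)) / 4)) * Real.exp ((κ / 2) * ρ) * CT))
        * (Real.sqrt (((Lc ^ (k + 1) : ℕ) : ℝ)))⁻¹ * Real.exp (-(min (κ / 2) (δ / 2)) * l1 (y - U₀)))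
      (κ / 4) := by
  have hL : 1 ≤ Lc ^ (k + 1) := Nat.one_le_pow _ _ (Nat.pos_of_ne_zero (NeZero.ne Lc))
  -- weaken the three envelopes from rate κ₀ to rate κ
  have h0 : ∀ (μ : Fin (3 + 1)) (z : Fin (3 + 1) → ℤ) (l'' : Fin (3 + 1)) (w' : Fin (3 + 1) → ℤ),
      |respStep (d := 3) (Lc ^ (m + 1)) (Lc ^ (m + 1 + k + 1)) μ z l'' w'|
        ≤ A * ((((Lc ^ (k + 1) : ℕ) : ℝ)) ^ (3 + 2))⁻¹ * Real.exp (-κ * l1 (quo (Lc ^ (k + 1)) w' - z)) :=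
    fun μ z l'' w' => exp_rate_weaken hκκ₀ (l1_nonneg _) (by positivity) (hU0 μ z l'' w')
  have h1 : ∀ (μ : Fin (3 + 1)) (z : Fin (3 + 1) → ℤ) (l'' : Fin (3 + 1)) (w' : Fin (3 + 1) → ℤ) (ν : Fin (3 + 1)),
      |respStep (d := 3) (Lc ^ (m + 1)) (Lc ^ (m + 1 + k + 1)) μ z l'' (w' + Pi.single ν 1) - respStep (d := 3) (Lc ^ (m + 1)) (Lc ^ (m + 1 + k + 1)) μ z l'' w'|
        ≤ A' * ((((Lc ^ (k + 1) : ℕ) : ℝ)) ^ (3 + 3))⁻¹ * Real.exp (-κ * l1 (quo (Lc ^ (k + 1)) w' - z)) :=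
    fun μ z l'' w' ν => exp_rate_weaken hκκ₀ (l1_nonneg _) (by positivity) (hU1 μ z l'' w' ν)
  have h2 : ∀ (μ : Fin (3 + 1)) (z : Fin (3 + 1) → ℤ) (l'' : Fin (3 + 1)) (w' : Fin (3 + 1) → ℤ) (ν ν' : Fin (3 + 1)),
      |(respStep (d := 3) (Lc ^ (m + 1)) (Lc ^ (m + 1 + k + 1)) μ z l'' (w' + Pi.single ν 1 + Pi.single ν' 1)
          - respStep (d := 3) (Lc ^ (m + 1)) (Lc ^ (m + 1 + k + 1)) μ z l'' (w' + Pi.single ν' 1))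
        - (respStep (d := 3) (Lc ^ (m + 1)) (Lc ^ (m + 1 + k + 1)) μ z l'' (w' + Pi.single ν 1) - respStep (d := 3) (Lc ^ (m + 1)) (Lc ^ (m + 1 + k + 1)) μ z l'' w')|
        ≤ A'' * ((((Lc ^ (k + 1) : ℕ) : ℝ)) ^ (3 + 3) * Real.sqrt (((Lc ^ (k + 1) : ℕ) : ℝ)))⁻¹ * Real.exp (-κ * l1 (quo (Lc ^ (k + 1)) w' - z)) :=
    fun μ z l'' w' ν ν' => exp_rate_weaken hκκ₀ (l1_nonneg _) (by positivity) (hU2 μ z l'' w' ν ν')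
  exact biLoc_cubic_push₃_layer_three_weight hL hκ hm hδ hA hA' hA'' hCs hB hκδZ h0 h1 h2 h0 h1 h2 h0 h1 h2 hS y hω hQ hZ hM0 hP1 hTl hTcard ν U₀

/-! ## §3 The leg rows DISCHARGED: leaf-12 ∕ leaf-02's envelopes BY NAME -/

/-- NOT IN PRINT; OUR BOOKKEEPING.  **THE (UUU) CELL OF THE LAYER BOUND, LEG ROWS DISCHARGED** (`RespStepSecondDiff.exists_respStep_decay_grad_diff2_l1` ⨾ §2): there are a rate
`κ₀ > 0` and constants `A, A′, A″ ≥ 0`, FREE OF THE LEVELS, such that for every pair `(m, k)`, every wobble rate `0 < κ ≤ κ₀` and all letter data satisfying the letter-side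
rows of the (LT-3) END at `κ`, the cubic-weighted push of the letter through THREE copies of the undressed composite column `respStep (Lc^(m+1)) (Lc^(m+1+k+1))` is bi-localised at
the output slot with ratio `(√(Lc^(k+1)))⁻¹`, weight `e^{−min(κ∕2,δ∕2)‖y−U₀‖₁}`, rate `κ∕4` and the END's explicit constant.  Modulo the letter side ONLY. -/
theorem exists_biLoc_cubic_push₃_respStep_three :
    ∃ κ₀ A A' A'' : ℝ, 0 < κ₀ ∧ 0 ≤ A ∧ 0 ≤ A' ∧ 0 ≤ A'' ∧
      ∀ (m k : ℕ) (κ : ℝ), 0 < κ → κ ≤ κ₀ →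
      ∀ (S : Fin (3 + 1) → (Fin (3 + 1) → ℤ) → MKer (3 + 1) (Fib 3)) (ω : (Fin (3 + 1) → ℤ) → ℝ)
        (Z : Fin (3 + 1) → Fin (3 + 1) → Fin (3 + 1) → (Fin (3 + 1) → ℤ) → (Fin (3 + 1) → ℤ) → ℝ) (T' : Finset (Fin (3 + 1) → ℤ))
        (Cs m' δ B δZ ρ CT : ℝ), κ < m' → 0 < δ → 0 ≤ Cs → 0 ≤ B → 4 * κ < δZ →
        (∀ k' u x z a b, |S k' u x z a b| ≤ Cs * ω u * Real.exp (-m' * (l1 (x - u) + l1 (z - u)))) →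
        ∀ (y : Fin (3 + 1) → ℤ),
        (∀ u, 0 ≤ ω u ∧ ω u ≤ ∑ μ : Fin (3 + 1),
          (∑ v ∈ ((box (3 + 1) (Lc ^ (k + 1))).filter (fun v => v μ = Lc ^ (k + 1) - 1)).image (fun v => ((Lc ^ (k + 1) : ℕ) : ℤ) • y + toSite v),
              Real.exp (-δ * l1 (v - u))
            + ∑ v ∈ ((box (3 + 1) (Lc ^ (k + 1))).filter (fun v => v μ = 0)).image (fun v => ((Lc ^ (k + 1) : ℕ) : ℤ) • y + toSite v - unitVec μ),
                Real.exp (-δ * l1 (v - u)))) →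
        (∀ k' κ₁ κ₂ u, ∑' x, ∑' z, S k' u x z (Sum.inl κ₁) (Sum.inl κ₂) = ∑ y' ∈ T', Z k' κ₁ κ₂ y' u) →
        (∀ k' κ₁ κ₂, ∀ y' ∈ T', ∀ e, |Z k' κ₁ κ₂ y' e| ≤ B * Real.exp (-δZ * l1 (e - y'))) →
        (∀ k' κ₁ κ₂, ∀ y' ∈ T', ∑' e, Z k' κ₁ κ₂ y' e = 0) →
        (∀ k' κ₁ κ₂, ∀ y' ∈ T', ∀ i : Fin (3 + 1), ∑' e, (((e - y') i : ℤ) : ℝ) * Z k' κ₁ κ₂ y' e = 0) →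
        (∀ y' ∈ T', l1 (quo (Lc ^ (k + 1)) y' - y) ≤ ρ) → ((T'.card : ℝ) ≤ CT * (((Lc ^ (k + 1) : ℕ) : ℝ)) ^ (3 + 1)) →
        ∀ (ν : Fin (3 + 1)) (U₀ : Fin (3 + 1) → ℤ),
        BiLoc (((((Lc ^ (k + 1) : ℕ) : ℝ)) ^ (3 * (3 + 1))) •
            push₃ (respStep (d := 3) (Lc ^ (m + 1)) (Lc ^ (m + 1 + k + 1))) (respStep (d := 3) (Lc ^ (m + 1)) (Lc ^ (m + 1 + k + 1)))
              (respStep (d := 3) (Lc ^ (m + 1)) (Lc ^ (m + 1 + k + 1))) S ν U₀) U₀ U₀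
          ((((((3 : ℝ) + 1) ^ 3 * A ^ 2 * A' * Cs * (2 / (m' - κ) * Zl (3 + 1) ((m' - κ) / 2)) * (Zl (3 + 1) (m' - κ) + Zl (3 + 1) m'))
                * ((2 * ((3 : ℝ) + 1)) ^ 2 * Zl (3 + 1) (δ / 2) * Real.exp (min (κ / 2) (δ / 2))))
            + ((3 : ℝ) + 1) ^ 3 *
              ((((A'' * A * A + 2 * A' * A' * A + A * A'' * A) * Real.exp (2 * κ) + 2 * ((A' * A + A * A') * Real.exp κ) * A' + A * A * A'')
                  * Real.exp (2 * (2 * κ))) * B * (8 / (δZ - 2 * (2 * κ)) ^ 2 * Zl (3 + 1) ((δZ - 2 * (2 * κ)) / 4)) * Real.exp ((κ / 2) * ρ) * CT))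
            * (Real.sqrt (((Lc ^ (k + 1) : ℕ) : ℝ)))⁻¹ * Real.exp (-(min (κ / 2) (δ / 2)) * l1 (y - U₀)))
          (κ / 4) := by
  obtain ⟨κ₀, A, A', A'', hκ₀, hA, hA', hA'', h0, h1, h2⟩ := exists_respStep_decay_grad_diff2_l1 (Lc := Lc)
  refine ⟨κ₀, A, A', A'', hκ₀, hA, hA', hA'', ?_⟩
  intro m k κ hκ hκκ₀ S ω Z T' Cs m' δ B δZ ρ CT hm hδ hCs hB hκδZ hS y hω hQ hZ hM0 hP1 hTl hTcard ν U₀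
  exact biLoc_cubic_push₃_respStep_three m k hκ hκκ₀ hA hA' hA'' (h0 (m + 1) k) (h1 (m + 1) k) (h2 (m + 1) k)
    hm hδ hCs hB hκδZ hS y hω hQ hZ hM0 hP1 hTl hTcard ν U₀

end Three

end Summit.QuantumFields.BalabanUV.Beta.GAN24.LayerTransportUndressedThree

end
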